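import Summits.ResolutionOfSingularities.ResolutionOfSingularities.Theorems.RadicialJungCleanModelsCcurveRegImage
import HarnessLib

/-!
# Route `RadicialJung`, crux `CleanModels` (stmt-15917) — (C-curve) sub-line, `curveRegularize` (classical route) IV: the residue of a quadratic transform along
# `O` is the quadratic transform of the residue along `V̄`

Lead `res-B-lead-1` g7 (workfile `Lines/Sketch_Ccurve_assembly.lean` v2.9, S3-core `stub_Cc_curveRegularize`; classical, F-32-free route).  OURS · counted 0.
Nothing here proves resolution in characteristic `p`; resolution in char `p` is NOT proved.

Setting of `…CcurveRegResidue` / `…CcurveRegImage`.  If `T → T′` is a quadratic transform along `O` of local subrings of `R₁` and `T` contains an `O`-non-unit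
which is an `O₁`-unit, then the image of `T′` in `L = κ(R₁)` is the quadratic transform of the image of `T` along the residue valuation ring `V̄`
(`img_quadraticTransform`): the generator `u₀` of maximal value is an `O₁`-unit (✓ `…CcurveRegInside`), the images of the generators generate the maximal
ideal of the image, their `V̄`-values compare as the `O`-values (✓ `residueVal_le_iff`), and the image of the chart is the chart of the images
(✓ `img_closure`, ✓ `img_locAtCentre`).  Hence the residue of the quadratic SEQUENCE along `O` is a quadratic sequence along `V̄` (`img_quadraticSeq`) — the
strict transforms of the centre curve.
-/

noncomputable section

set_option linter.dupNamespace false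

open IsLocalRing Literature.AlgebraicGeometry.Resolution
open Summit.ResolutionOfSingularities.ResolutionOfSingularities.Theorems
open Summit.ResolutionOfSingularities.ResolutionOfSingularities.Theorems.SwitchingDichotomy

namespace Summit.ResolutionOfSingularities.ResolutionOfSingularities.Theorems.RadicialJung.CleanModels.Ccurve

variable {K : Type} [Field K]

section step

variable {R₁ : Subring K} [IsLocalRing ↥R₁] {O O₁ : ValuationSubring K} (hOO₁ : O ≤ O₁) (hR₁O₁ : R₁ ≤ O₁.toSubring)
  (hinv : ∀ {r : K}, r ∈ R₁ → O₁.valuation r = 1 → r⁻¹ ∈ R₁)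
  (V : ValuationSubring (ResidueField ↥R₁)) (hV₁ : ∀ r : ↥R₁, (r : K) ∈ O → residue ↥R₁ r ∈ V)
  (hV₂ : ∀ ξ : ResidueField ↥R₁, ξ ∈ V → ∃ r : ↥R₁, (r : K) ∈ O ∧ residue ↥R₁ r = ξ)

include hOO₁ in
/-- In a quadratic transform `T → T′` along `O` whose source contains an `O`-non-unit `O₁`-unit `x`, the generator `u₀` of maximal value is an `O₁`-unit.
[folklore] -/
theorem valuation_coarse_gen_eq_one {T : Subring K} [IsLocalRing ↥T] (hTO : T ≤ O.toSubring)
    (u : Finset ↥T) (u₀ : ↥T) (hspan : Ideal.span (↑u : Set ↥T) = maximalIdeal ↥T)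
    (hmax : ∀ y ∈ u, O.valuation ((y : ↥T) : K) ≤ O.valuation ((u₀ : ↥T) : K))
    {x : K} (hxT : x ∈ T) (hvx : O.valuation x < 1) (hvx₁ : O₁.valuation x = 1) : O₁.valuation ((u₀ : ↥T) : K) = 1 := by
  have hTO₁ : T ≤ O₁.toSubring := fun w hw => hOO₁ (hTO hw)
  have hxm : (⟨x, hxT⟩ : ↥T) ∈ maximalIdeal ↥T := by
    rw [IsLocalRing.mem_maximalIdeal, mem_nonunits_iff, isUnit_subring_iff_inv_mem]
    rintro ⟨hx0, hxinv⟩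
    have h1 : O.valuation x⁻¹ ≤ 1 := (O.valuation_le_one_iff _).mpr (hTO hxinv)
    rw [map_inv₀, inv_le_one₀ ((Valuation.pos_iff _).mpr hx0)] at h1
    exact not_le.mpr hvx h1
  have hgen : ∃ y ∈ u, O₁.valuation ((y : ↥T) : K) = 1 := by
    by_contra hall
    push Not at hall
    have hsub : (↑u : Set ↥T) ⊆ (subringCentre T O₁ hTO₁ : Set ↥T) := fun y hy =>
      (mem_subringCentre_iff hTO₁ y).mpr (lt_of_le_of_ne ((O₁.valuation_le_one_iff _).mpr (hTO₁ y.2)) (hall y hy))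
    have hle : maximalIdeal ↥T ≤ subringCentre T O₁ hTO₁ := by rw [← hspan]; exact Ideal.span_le.mpr hsub
    have : O₁.valuation x < 1 := (mem_subringCentre_iff hTO₁ ⟨x, hxT⟩).mp (hle hxm)
    rw [hvx₁] at this; exact lt_irrefl _ this
  obtain ⟨y, hyu, hvy⟩ := hgen
  apply le_antisymm ((O₁.valuation_le_one_iff _).mpr (hTO₁ u₀.2))
  rw [← hvy]
  exact valuation_le_valuation_of_le hOO₁ (hmax y hyu)

include hOO₁ hR₁O₁ hinv hV₁ hV₂ in
open scoped Classical in
/-- **The residue of a quadratic transform along `O` is the quadratic transform of the residue along `V̄`.** [folklore] -/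
theorem img_quadraticTransform {T T' : Subring K} (hT : T ≤ R₁) (hT' : T' ≤ R₁)
    (hqt : IsQuadraticTransformAlong O T T') {x : K} (hxT : x ∈ T) (hvx : O.valuation x < 1) (hvx₁ : O₁.valuation x = 1) :
    IsQuadraticTransformAlong V ((residue ↥R₁).comp (Subring.inclusion hT)).range ((residue ↥R₁).comp (Subring.inclusion hT')).range := by
  obtain ⟨hloc, hTO, u, u₀, hspan, hu₀, hu₀0, hmax, hT'eq⟩ := hqt
  haveI := hloc
  subst hT'eq
  have hvu₀ : O₁.valuation ((u₀ : ↥T) : K) = 1 := valuation_coarse_gen_eq_one hOO₁ hTO u u₀ hspan hmax hxT hvx hvx₁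
  -- the chart lies in `R₁`
  have hC : Subring.closure ((T : Set K) ∪ (fun y : ↥T => (y : K) / u₀) '' ↑u) ≤ R₁ := by
    rw [Subring.closure_le]
    rintro w (hw | ⟨y, -, rfl⟩)
    · exact hT hw
    · change (y : K) / u₀ ∈ R₁
      rw [div_eq_mul_inv]; exact Subring.mul_mem _ (hT y.2) (hinv (hT u₀.2) hvu₀)
  -- the image ring and its surjection
  set ψ := ((residue ↥R₁).comp (Subring.inclusion hT)).rangeRestrict with hψ
  haveI hlocimg : IsLocalRing ↥((residue ↥R₁).comp (Subring.inclusion hT)).range :=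
    IsLocalRing.of_surjective' _ (RingHom.rangeRestrict_surjective ((residue ↥R₁).comp (Subring.inclusion hT)))
  have hψval : ∀ y : ↥T, ((ψ y : ↥((residue ↥R₁).comp (Subring.inclusion hT)).range) : ResidueField ↥R₁) =
      residue ↥R₁ ⟨(y : K), hT y.2⟩ := fun y => rfl
  refine ⟨hlocimg, img_le_residueVal V hV₁ hT hTO, u.image ψ, ψ u₀, ?_, Finset.mem_image_of_mem _ hu₀, ?_, ?_, ?_⟩
  · -- the images of the generators generate the maximal ideal
    rw [Finset.coe_image, ← Ideal.map_span, hspan]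
    exact map_maximalIdeal_img hT
  · -- `ū₀ ≠ 0`
    intro h0
    have : residue ↥R₁ ⟨(u₀ : K), hT u₀.2⟩ = 0 := by rw [← hψval, h0]; rfl
    exact ((residue_ne_zero_iff_coarse hR₁O₁ hinv ⟨(u₀ : K), hT u₀.2⟩).mpr hvu₀) this
  · -- order of values
    intro ybar hybar
    obtain ⟨y, hy, rfl⟩ := Finset.mem_image.mp hybar
    rw [hψval, hψval]
    exact (residueVal_le_iff hOO₁ hR₁O₁ hinv V hV₁ hV₂ ⟨(y : K), hT y.2⟩ ⟨(u₀ : K), hT u₀.2⟩ hvu₀).mpr (hmax y hy)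
  · -- the image of the chart is the chart of the images
    rw [img_locAtCentre hOO₁ hR₁O₁ hinv V hV₁ hV₂ hC hT', img_closure hR₁O₁ hinv hT u u₀ hvu₀ hC]

include hOO₁ hR₁O₁ hinv hV₁ hV₂ in
/-- **The residue of the quadratic sequence along `O` is a quadratic sequence along `V̄`.** [folklore] -/
theorem img_quadraticSeq (R : ℕ → Subring K) (hR : ∀ i, R i ≤ R₁) (hstep : ∀ i, IsQuadraticTransformAlong O (R i) (R (i + 1)))
    {x : K} (hx0 : x ∈ R 0) (hvx : O.valuation x < 1) (hvx₁ : O₁.valuation x = 1) :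
    ∀ i, IsQuadraticTransformAlong V ((residue ↥R₁).comp (Subring.inclusion (hR i))).range
      ((residue ↥R₁).comp (Subring.inclusion (hR (i + 1)))).range := fun i =>
  img_quadraticTransform hOO₁ hR₁O₁ hinv V hV₁ hV₂ (hR i) (hR (i + 1)) (hstep i) (sequence_monotone hstep (Nat.zero_le i) hx0) hvx hvx₁

end step

end Summit.ResolutionOfSingularities.ResolutionOfSingularities.Theorems.RadicialJung.CleanModels.Ccurve

end
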